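import Summits.ResolutionOfSingularities.ResolutionOfSingularities.Theorems.EquisingularLiftEquisingularLiftNatHypLocPrincipalForm
import Summits.ResolutionOfSingularities.ResolutionOfSingularities.Theorems.EquisingularLiftEquisingularLiftRegularCase
import Summits.ResolutionOfSingularities.ResolutionOfSingularities.Theorems.EquisingularLiftEquisingularLiftCurveCase
import Summits.ResolutionOfSingularities.ResolutionOfSingularities.Theses.EquisingularLift
import HarnessLib

/-!
# Crux `EquisingularLift` (stmt-ResolutionOfSingularities-15660) reduces EXACTLY to prime-form hypersurfaces `V₊(F) ⊆ ℙⁿ`, `n ≥ 3`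

leafhand-res-equisingularlift-5 g0 (prover, 2026-08-31; cell `pub/decomp-res`; item (r1) of leafhand-4's repair census, applied to the bookkeeping
crux).  DEF-FREE; no `sorry`; standard axioms; ZERO named hypotheses; `--supports stmt-…-15660 --as helper`, counted 0.

The route decl `Theses.EquisingularLift.EquisingularLift` quantifies over closed immersions `ι : H ↪ ℙⁿ_k` with `H` integral and `ker ι` locally
principal.  By the dictionary ✓ `LargeChar.isIso_or_exists_prime_form_range_eq_of_hyp` (…NatHypLocPrincipalForm) such an `ι` is an isomorphism —
and then ✓ `Theorems.EquisingularLift.equisingularLift_of_isRegular` settles it (`ℙⁿ` is regular) — or `range ι = V₊(F)` with `𝔭_{ι(η_H)} = (F)` for a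
PRIME FORM `F` of degree `≥ 1`; and `n ≤ 2` is settled by ✓ `equisingularLift_of_le_two` (…CurveCase).  Hence:

* ★ `equisingularLift_of_primeForms` — **`EquisingularLift` follows from its instances with `n ≥ 3` and `range ι = V₊(F)`,
  `F` a prime form of degree `e ≥ 1`** (the honest residual content of the crux: integral HYPERSURFACES of `ℙⁿ`, `n ≥ 3`, given by ONE
  irreducible equation).

HONEST: a reduction, not a proof — `EquisingularLift` / EL♮ / EL♮(3) are NOT proved; no registered stub (`stub_CJS2020Sequence`, `stub_CP2019General`,
`stub_blowupModel_ge_five`) is closed; resolution of singularities in positive characteristic is NOT proved.  AI-written; AI review is weaker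
than expert review. [cite: Hartshorne1977, II Prop. 6.4] (method; index only)
-/

set_option linter.dupNamespace false -- mandated namespace `Summit.<Summit>.<Problem>` of this single-conjunct summit

noncomputable section

open CategoryTheory CategoryTheory.Limits AlgebraicGeometry TopologicalSpace Topology
open Literature.AlgebraicGeometry.Resolution Literature.AlgebraicGeometry.Motives
open Summit.ResolutionOfSingularities.ResolutionOfSingularities.Cruxes.EquisingularLiftNat.Sections

namespace Summit.ResolutionOfSingularities.ResolutionOfSingularities.Cruxes.EquisingularLift.StrataSplit

/-- ★ **`EquisingularLift` reduces exactly to prime-form hypersurfaces in `ℙⁿ`, `n ≥ 3`.**  If the conclusion of the crux holds for every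
`(p, k, n, H, ι)` satisfying its hypotheses with `n ≥ 3` AND `range ι = V₊(F)` for some PRIME FORM `F` of degree `e ≥ 1`
(hypothesis `h`), then the route decl `Theses.EquisingularLift.EquisingularLift` holds: `n ≤ 2` by ✓ `equisingularLift_of_le_two`, the
isomorphism case by ✓ `equisingularLift_of_isRegular` (`ℙⁿ` is regular), the rest is `h` through the dictionary
✓ `LargeChar.isIso_or_exists_prime_form_range_eq_of_hyp`. [OURS · DEF-FREE · pure reduction] -/
theorem equisingularLift_of_primeForms
    (h : ∀ p : ℕ, p.Prime → ∀ (k : Type) [Field k] [CharP k p] [IsAlgClosed k] (n : ℕ) (H : AlgebraicGeometry.Scheme.{0}) (ι : H ⟶ (Literature.AlgebraicGeometry.Motives.projectiveSpace n k).left), AlgebraicGeometry.IsClosedImmersion ι → AlgebraicGeometry.IsIntegral H → (∀ y : (Literature.AlgebraicGeometry.Motives.projectiveSpace n k).left, ∃ U : (Literature.AlgebraicGeometry.Motives.projectiveSpace n k).left.affineOpens, y ∈ (U : (Literature.AlgebraicGeometry.Motives.projectiveSpace n k).left.Opens) ∧ (ι.ker.ideal U).IsPrincipal) → 3 ≤ n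 → ∀ (e : ℕ) (F : MvPolynomial (Fin (n + 1)) k), 0 < e → F.IsHomogeneous e → Prime F → (letI := MvPolynomial.gradedAlgebra (σ := Fin (n + 1)) (R := k); Set.range ι = {x : AlgebraicGeometry.Proj (MvPolynomial.homogeneousSubmodule (Fin (n + 1)) k) | F ∈ x.asHomogeneousIdeal}) → ∃ (O : Type) (_ : CommRing O) (_ : IsDomain O) (_ : IsDiscreteValuationRing O) (_ : CharZero O) (P P' : AlgebraicGeometry.Scheme.{0}) (q : P ⟶ AlgebraicGeometry.Spec (.of O)) (Y : TopologicalSpace.Closeds P) (σ : P' ⟶ P) (S' : Set P'), AlgebraicGeometry.Smooth q ∧ AlgebraicGeometry.IsProper q ∧ (Y : Set P) ⊆ q ⁻¹' {IsLocalRing.closedPoint O} ∧ Nonempty ((AlgebraicGeometry.Scheme.IdealSheafData.vanishingIdeal Y).subscheme ≅ H) ∧ (∀ Q : (∀ X' : AlgebraicGeometry.Scheme.{0}, (X' ⟶ P) → Set X' → Prop), Q P (CategoryTheory.CategoryStruct.id P) (Y : Set P) → (∀ (X' X'' : AlgebraicGeometry.Scheme.{0}) (σ' : X' ⟶ P) (Y'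 : Set X') (C : X'.IdealSheafData) (τ : X'' ⟶ X'), Q X' σ' Y' → Literature.AlgebraicGeometry.Resolution.IsBlowup τ C → Literature.AlgebraicGeometry.Resolution.Scheme.IsRegular C.subscheme → σ' '' (C.support : Set X') ⊆ {x : P | ¬ IsGenericPoint x (Y : Set P)} → Q X'' (CategoryTheory.CategoryStruct.comp τ σ') (closure (τ ⁻¹' (Y' \ (C.support : Set X'))))) → Q P' σ S') ∧ IsIrreducible ((CategoryTheory.CategoryStruct.comp σ q) ⁻¹' {IsLocalRing.closedPoint O}) ∧ Literature.AlgebraicGeometry.Resolution.Scheme.IsRegular (AlgebraicGeometry.Scheme.IdealSheafData.vanishingIdeal (⟨closure S', isClosed_closure⟩ : TopologicalSpace.Closeds P')).subscheme) :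
    Summit.ResolutionOfSingularities.ResolutionOfSingularities.Theses.EquisingularLift.EquisingularLift := by
  refine equisingularLift_of_ge_three ?_
  intro p hp k _ _ _ n H ι hι hH hpr hn
  haveI := hι
  haveI := hH
  rcases LargeChar.isIso_or_exists_prime_form_range_eq_of_hyp ι hpr with hiso | ⟨e, F, he, hF, hprime, -, hrange⟩
  · haveI := hiso
    exact Theorems.EquisingularLift.equisingularLift_of_isRegular p hp k n H ι hι hH hpr
      (Scheme.IsRegular.of_iso (inv ι) (isRegular_projectiveSpace n k))
  · exact h p hp k n H ι hι hH hpr hn e F he hF hprime hrange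

end Summit.ResolutionOfSingularities.ResolutionOfSingularities.Cruxes.EquisingularLift.StrataSplit

end
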